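import Literature.Combinatorics.StablePolynomials.HeilmannLiebTheorem
import HarnessLib

/-!
# Degree-weighted graph polynomials: Wagner's theorem (Borcea–Brändén II, Theorem 8.10, §8.5)

J. Borcea, P. Brändén, *The Lee–Yang and Pólya–Schur programs. II.*, Comm. Pure Appl. Math. 62 (2009)
1595–1631 (arXiv:0809.3087), §8.5:

> Let `κ = (κ_1,…,κ_n) ∈ ℕⁿ` and suppose that `deg G ≤ κ`. Then given degree weights `u : ℕ^κ → ℂ` and
> non-negative edge weights `{λ_e}_{e∈E}` one may ask what are the non-vanishing properties of the polynomial
> `F_G(z,λ,u) = Σ_{H⊆E} λ^H u(deg(V,H)) z^{deg(V,H)}`. … it is natural (and of course sufficient) to require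
> that the linear "truncation" operator `T : ℂ_κ[z] → ℂ_κ[z]` defined by `T(z^α) = u(α)z^α`, `α ≤ κ`, preserves
> weak Hurwitz stability. … `u(α) = u_1(α_1)⋯u_n(α_n)`, `α ≤ κ`, where for each `i ∈ [n]` the polynomial
> `Σ_{k=0}^{κ_i} binom(κ_i,k) u_i(k) z^k` (uik) has all real non-positive zeros. …
>
> **Theorem 8.10** (Wagner [W2]). Let `G = (V,E)` be a graph whose degree vector satisfies `deg G ≤ κ` and let
> `F_G(z,λ,u)` and `u` be as above and in (uik), respectively. If `{λ_e}_{e∈E}` are non-negative edge weights then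
> (a) `F_G(z,λ,u)` is weakly Hurwitz stable considered as a polynomial in `z`;
> (b) All zeros of the univariate polynomial `Σ_{k=0}^{|E|} (Σ_{H⊆E, |H|=k} u(deg(V,H)) λ^H) t^k` are real and
> non-positive.
>
> *Proof.* The first statement follows from Corollary 4.6 and the fact that the test polynomial
> [`F_G(z,λ) = Π_e (1 + λ_e z_i z_j)` of §8.4] is weakly Hurwitz stable. If we set all the `z_j`'s equal to
> `-it` we obtain the univariate polynomial (in `t`) `Σ_k (Σ_{|H|=k} u(deg(V,H)) λ^H) (-1)^k t^{2k}` which is then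
> real stable. Clearly, this forces the polynomial in (b) to have all zeros real and non-positive.

This file proves (a), with the sufficiency it needs — a product-form multiplier `u` whose polynomials (uik) have
only real non-positive zeros preserves weak Hurwitz stability on `ℂ_κ[z]` — obtained directly from Theorem 3.2
for `C = H_{π/2}` (`BorceaBranden_rightHalfPlaneStabilityPreserver_iff`): the symbol is
`T[(1+zw)^κ] = Π_i p_i(z_iw_i)` with `p_i` the polynomial (uik), and `z_iw_i ∉ (-∞,0]` for `z_i, w_i ∈ H_{π/2}`.
The conclusion is "weakly Hurwitz stable or identically zero" (e.g. an isolated vertex `v` with `u_v(0) = 0`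
makes `F_G(z,λ,u) ≡ 0`); correspondingly (b) is stated for `F_G(z,λ,u) ≢ 0`, with the polynomial of (b) as the
function `s ↦ Σ_{H⊆E} λ^H u(deg(V,H)) s^{|H|}` and the substitution `z_j = -it`, `t² = -s`, of the printed proof.

-- TODO(general form): the necessity half of Corollary 4.6.

## Contents

* §1 `degreeMultiplier κ u` (`T(z^α) = u(α)z^α`, `u(α) = Π u_i(α_i)`), `uikPoly` (the polynomial (uik) as a
  function), `eval_degreeMultiplier_symbol` (`T[(1+zw)^κ](z) = Π_i p_i(w_iz_i)`), `not_nonpos_real_of_re_pos`,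
  `isHThetaStable_boundedDegreeSymbolD_degreeMultiplier`, **`degreeMultiplier_weaklyHurwitzStable`**
  (Corollary 4.6, sufficiency, in the form (uik)).
* §2 `degreeWeightedPolynomial` (`F_G(z,λ,u)`), `degreeMultiplier_testPolynomial`,
  `degreeOf_testPolynomial_le`, **`wagner_degreeWeightedPolynomial_weaklyHurwitzStable`** (Theorem 8.10 (a)).
* §3 `sum_edgeDegVec_eq_two_mul_card` (handshake), `eval_const_degreeWeightedPolynomial` (`z_j = c` for all `j`),
  `edgeCountPoly` (the polynomial of (b) as a function), **`wagner_edgeCountPoly_zeros_real_nonpos`**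
  (Theorem 8.10 (b)).

## References

* [BorceaBranden2009II] J. Borcea, P. Brändén, Comm. Pure Appl. Math. 62 (2009) 1595–1631, §8.5 Thm 8.10, §4
  Cor 4.6.
* D. G. Wagner, *Weighted enumeration of spanning subgraphs with degree constraints*, J. Combin. Theory Ser. B
  99 (2009) 347–357 (the reference [W2] of [BorceaBranden2009II]).
-/

noncomputable section

open MvPolynomial Finset

namespace Literature.Combinatorics.StablePolynomials

variable {σ : Type*} [Fintype σ] [DecidableEq σ]

/-! ## §1 Product-form multipliers with (uik) preserve weak Hurwitz stability -/

section Multiplier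

/-- **The truncation / multiplier operator `T(z^α) = u(α) z^α` with `u(α) = Π_i u_i(α_i)`.**
[cite: BorceaBranden2009II, §8.5 (the operator `T(z^α) = u(α)z^α`, `u(α) = u_1(α_1)⋯u_n(α_n)`)] -/
def degreeMultiplier (u : σ → ℕ → ℂ) : MvPolynomial σ ℂ →ₗ[ℂ] MvPolynomial σ ℂ :=
  mvMultiplierOp fun s => ∏ i, u i (s i)

omit [Fintype σ] [DecidableEq σ] in
/-- **The polynomial (uik)** `p_i(x) = Σ_{k=0}^{κ_i} binom(κ_i,k) u_i(k) x^k`, as a function.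
[cite: BorceaBranden2009II, §8.5 eq. (uik)] -/
def uikPoly (κ : ℕ) (u : ℕ → ℂ) (x : ℂ) : ℂ :=
  ∑ k ∈ range (κ + 1), ((κ.choose k : ℕ) : ℂ) * u k * x ^ k

/-- **The symbol of `T`**: `T[Π_i(1+w_iz_i)^{κ_i}](z) = Π_i p_i(w_iz_i)`.
[cite: BorceaBranden2009II, §4 proof of Cor. 4.6 ("`T[(z+w)^κ] = Σ binom(κ,α) λ(α) z^α w^{κ-α}`"), §8.5] -/
theorem eval_degreeMultiplier_symbol (κ : σ → ℕ) (u : σ → ℕ → ℂ) (z w : σ → ℂ) :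
    eval z (degreeMultiplier u (∏ i, (1 + C (w i) * X i) ^ κ i)) = ∏ i, uikPoly (κ i) (u i) (w i * z i) := by
  rw [apply_prod_one_add_C_mul_X_pow, map_sum]
  have hterm : ∀ α ∈ Fintype.piFinset (fun i => range (κ i + 1)),
      eval z ((∏ i, (((κ i).choose (α i) : ℕ) : ℂ) * w i ^ α i) • degreeMultiplier u (∏ i, X i ^ α i)) =
        ∏ i, ((((κ i).choose (α i) : ℕ) : ℂ) * u i (α i) * (w i * z i) ^ α i) := by
    intro α _
    rw [degreeMultiplier, mvMultiplierOp_prod_X_pow, smul_eval, smul_eval, _root_.map_prod]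
    simp only [toF_apply, map_pow, eval_X]
    rw [← prod_mul_distrib, ← prod_mul_distrib]
    exact prod_congr rfl fun i _ => by rw [mul_pow]; ring
  rw [sum_congr rfl hterm, ← prod_univ_sum (fun i => range (κ i + 1))
    fun i a => (((κ i).choose a : ℕ) : ℂ) * u i a * (w i * z i) ^ a]
  rfl

omit [Fintype σ] [DecidableEq σ] in
/-- **`zw ∉ (-∞, 0]` for `z, w ∈ H_{π/2}`.** [cite: BorceaBranden2009II, §8.2 proof of Thm. 8.7
("`u^{-1}, v^{-1}, u+v ∈ H_{π/2}`"), §8.5] -/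
theorem not_nonpos_real_of_re_pos {z w : ℂ} (hz : 0 < z.re) (hw : 0 < w.re) :
    ¬((z * w).im = 0 ∧ (z * w).re ≤ 0) := by
  rintro ⟨him, hre⟩
  have hz0 : z ≠ 0 := fun h0 => by rw [h0, Complex.zero_re] at hz; exact lt_irrefl _ hz
  set t : ℝ := -(z * w).re with ht
  have hzw : z * w = -(t : ℂ) := Complex.ext (by simp [ht]) (by simp [him])
  have hw' : w = -(t : ℂ) * z⁻¹ := by field_simp; linear_combination hzw
  have : w.re ≤ 0 := by
    rw [hw', neg_mul, Complex.neg_re, Complex.re_ofReal_mul, Complex.inv_re, neg_nonpos]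
    exact mul_nonneg (by linarith) (div_nonneg hz.le (Complex.normSq_nonneg _))
  linarith

/-- **The symbol `Π_i p_i(z_iw_i)` is weakly Hurwitz stable** when every `p_i` has only real non-positive zeros.
[cite: BorceaBranden2009II, §4 Cor. 4.6 (proof), §8.5] -/
theorem isHThetaStable_boundedDegreeSymbolD_degreeMultiplier (κ : σ → ℕ) {u : σ → ℕ → ℂ}
    (hu : ∀ i (ζ : ℂ), uikPoly (κ i) (u i) ζ = 0 → ζ.im = 0 ∧ ζ.re ≤ 0) :
    IsHThetaStable (Real.pi / 2) (boundedDegreeSymbolD κ (degreeMultiplier u)) := by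
  rw [isHThetaStable_pi_div_two_iff]
  intro zw hzw
  rw [← Sum.elim_comp_inl_inr zw, eval_boundedDegreeSymbolD, eval_degreeMultiplier_symbol]
  exact prod_ne_zero_iff.2 fun i _ h => not_nonpos_real_of_re_pos (hzw _) (hzw _) (hu i _ h)

/-- **Borcea–Brändén II, Corollary 4.6 (sufficiency, in the form (uik) of §8.5)**: if `u(α) = Π_i u_i(α_i)` and
each `Σ_k binom(κ_i,k) u_i(k) z^k` has only real non-positive zeros, then `T(z^α) = u(α)z^α` maps weakly Hurwitz
stable polynomials of `ℂ_κ[z]` to weakly Hurwitz stable polynomials or to `0`.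
[cite: BorceaBranden2009II, §4 Cor. 4.6, §8.5 (uik)] -/
theorem degreeMultiplier_weaklyHurwitzStable (κ : σ → ℕ) {u : σ → ℕ → ℂ}
    (hu : ∀ i (ζ : ℂ), uikPoly (κ i) (u i) ζ = 0 → ζ.im = 0 ∧ ζ.re ≤ 0) {f : MvPolynomial σ ℂ}
    (hf : ∀ i, degreeOf i f ≤ κ i) (hs : IsHThetaStable (Real.pi / 2) f) :
    IsHThetaStable (Real.pi / 2) (degreeMultiplier u f) ∨ degreeMultiplier u f = 0 :=
  (BorceaBranden_rightHalfPlaneStabilityPreserver_iff κ (degreeMultiplier u)).2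
    (Or.inr (isHThetaStable_boundedDegreeSymbolD_degreeMultiplier κ hu)) f hf hs

end Multiplier

/-! ## §2 Theorem 8.10 (a) -/

section Wagner

/-- **`F_G(z,λ,u) = Σ_{H⊆E} λ^H u(deg(V,H)) z^{deg(V,H)}`** with `u(α) = Π_v u_v(α_v)`.
[cite: BorceaBranden2009II, §8.5 (definition of `F_G(z,λ,u)`)] -/
def degreeWeightedPolynomial (E : Finset (Finset σ)) (wt : Finset σ → ℝ) (u : σ → ℕ → ℂ) : MvPolynomial σ ℂ :=
  ∑ H ∈ E.powerset, monomial (edgeDegVec H) ((∏ e ∈ H, ((wt e : ℝ) : ℂ)) * ∏ v, u v (edgeDegVec H v))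

/-- `F_G(z,λ,u) = T[F_G(z,λ)]`. [cite: BorceaBranden2009II, §8.5 (proof of Thm. 8.10)] -/
theorem degreeMultiplier_testPolynomial (E : Finset (Finset σ)) (wt : Finset σ → ℝ) (u : σ → ℕ → ℂ) :
    degreeMultiplier u (testPolynomial E wt) = degreeWeightedPolynomial E wt u := by
  rw [testPolynomial_eq_sum, map_sum, degreeWeightedPolynomial]
  refine sum_congr rfl fun H _ => ?_
  rw [degreeMultiplier, mvMultiplierOp_monomial, mul_comm]

omit [Fintype σ] in
/-- `deg_{z_v} F_G(z,λ) ≤ deg_G(v)`. [cite: BorceaBranden2009II, §8.5 ("`deg G ≤ κ`")] -/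
theorem degreeOf_testPolynomial_le (E : Finset (Finset σ)) (wt : Finset σ → ℝ) (v : σ) :
    degreeOf v (testPolynomial E wt) ≤ (E.filter fun e => v ∈ e).card := by
  rw [testPolynomial, card_filter]
  refine (degreeOf_prod_le _ _ _).trans (sum_le_sum fun e _ => ?_)
  refine (degreeOf_add_le _ _ _).trans (max_le ?_ ?_)
  · rw [← C_1, degreeOf_C]; exact Nat.zero_le _
  · refine (degreeOf_C_mul_le _ _ _).trans ((degreeOf_prod_le _ _ _).trans ?_)
    split_ifs with hv
    · calc ∑ x ∈ e, degreeOf v (X x : MvPolynomial σ ℂ) ≤ ∑ x ∈ e, (if v = x then 1 else 0) :=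
            sum_le_sum fun x _ => (degreeOf_X (R := ℂ) v x).le
        _ = 1 := by rw [sum_ite_eq, if_pos hv]
    · refine (sum_eq_zero fun x hx => ?_).le
      rw [degreeOf_X, if_neg]
      rintro rfl
      exact hv hx

/-- **Borcea–Brändén II, Theorem 8.10 (a) (Wagner [W2]).** Let `G` be a graph with `deg G ≤ κ`, `λ_e ≥ 0`, and
`u(α) = Π u_i(α_i)` with each `Σ_k binom(κ_i,k)u_i(k)z^k` having only real non-positive zeros. Then
`F_G(z,λ,u) = Σ_{H⊆E} λ^H u(deg(V,H)) z^{deg(V,H)}` is weakly Hurwitz stable (or identically zero). Proof as printed: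
the sufficiency of Corollary 4.6 applied to the weakly Hurwitz stable test polynomial `F_G(z,λ)`.
[cite: BorceaBranden2009II, §8.5 Thm. 8.10 (a)] -/
theorem wagner_degreeWeightedPolynomial_weaklyHurwitzStable {E : Finset (Finset σ)} (hE : ∀ e ∈ E, e.card = 2)
    {κ : σ → ℕ} (hκ : ∀ v, (E.filter fun e => v ∈ e).card ≤ κ v) {wt : Finset σ → ℝ} (hwt : ∀ e ∈ E, 0 ≤ wt e)
    {u : σ → ℕ → ℂ} (hu : ∀ i (ζ : ℂ), uikPoly (κ i) (u i) ζ = 0 → ζ.im = 0 ∧ ζ.re ≤ 0) :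
    IsHThetaStable (Real.pi / 2) (degreeWeightedPolynomial E wt u) ∨ degreeWeightedPolynomial E wt u = 0 := by
  rw [← degreeMultiplier_testPolynomial]
  exact degreeMultiplier_weaklyHurwitzStable κ hu (fun v => (degreeOf_testPolynomial_le E wt v).trans (hκ v))
    (testPolynomial_weaklyHurwitzStable hE hwt)

end Wagner

/-! ## §3 Theorem 8.10 (b) -/

section Univariate

/-- **Handshake**: `Σ_v deg(V,H)_v = 2|H|` for an edge set of two-element sets.
[cite: BorceaBranden2009II, §8.5 proof of Thm. 8.10 ("`(-1)^k t^{2k}`")] -/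
theorem sum_edgeDegVec_eq_two_mul_card {H : Finset (Finset σ)} (hH : ∀ e ∈ H, e.card = 2) :
    ∑ v, edgeDegVec H v = 2 * H.card := by
  simp_rw [edgeDegVec_apply, card_filter]
  rw [sum_comm, mul_comm, ← smul_eq_mul, ← sum_const]
  refine sum_congr rfl fun e he => ?_
  rw [← card_filter, filter_mem_eq_inter, univ_inter, hH e he]

/-- **`F_G(c,…,c; λ, u) = Σ_H λ^H u(deg(V,H)) (c²)^{|H|}`.** [cite: BorceaBranden2009II, §8.5 proof of Thm. 8.10
("If we set all the `z_j`'s equal to `-it` …")] -/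
theorem eval_const_degreeWeightedPolynomial {E : Finset (Finset σ)} (hE : ∀ e ∈ E, e.card = 2)
    (wt : Finset σ → ℝ) (u : σ → ℕ → ℂ) (c : ℂ) :
    eval (fun _ : σ => c) (degreeWeightedPolynomial E wt u) =
      ∑ H ∈ E.powerset, ((∏ e ∈ H, ((wt e : ℝ) : ℂ)) * ∏ v, u v (edgeDegVec H v)) * (c ^ 2) ^ H.card := by
  rw [degreeWeightedPolynomial, map_sum]
  refine sum_congr rfl fun H hH => ?_
  rw [eval_monomial, Finsupp.prod_pow, prod_pow_eq_pow_sum,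
    sum_edgeDegVec_eq_two_mul_card fun e he => hE e (mem_powerset.1 hH he), pow_mul]

/-- **The univariate polynomial of Theorem 8.10 (b)**, `Σ_k (Σ_{H⊆E,|H|=k} u(deg(V,H)) λ^H) s^k`, as the function
`s ↦ Σ_{H⊆E} λ^H u(deg(V,H)) s^{|H|}`. [cite: BorceaBranden2009II, §8.5 Thm. 8.10 (b)] -/
def edgeCountPoly (E : Finset (Finset σ)) (wt : Finset σ → ℝ) (u : σ → ℕ → ℂ) (s : ℂ) : ℂ :=
  ∑ H ∈ E.powerset, ((∏ e ∈ H, ((wt e : ℝ) : ℂ)) * ∏ v, u v (edgeDegVec H v)) * s ^ H.card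

/-- **Borcea–Brändén II, Theorem 8.10 (b) (Wagner [W2]).** Under the hypotheses of (a), and when `F_G(z,λ,u) ≢ 0`,
every zero of `Σ_k (Σ_{|H|=k} u(deg(V,H)) λ^H) s^k` is real and non-positive. Proof as printed: a zero `s` off
`(-∞,0]` gives `t` with `t² = -s`, `Im t > 0`, and then `F_G(-it,…,-it) = Σ_H λ^H u(deg(V,H)) (-t²)^{|H|} = 0` with all
`-it ∈ H_{π/2}`, contradicting (a). [cite: BorceaBranden2009II, §8.5 Thm. 8.10 (b)] -/
theorem wagner_edgeCountPoly_zeros_real_nonpos {E : Finset (Finset σ)} (hE : ∀ e ∈ E, e.card = 2)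
    {κ : σ → ℕ} (hκ : ∀ v, (E.filter fun e => v ∈ e).card ≤ κ v) {wt : Finset σ → ℝ} (hwt : ∀ e ∈ E, 0 ≤ wt e)
    {u : σ → ℕ → ℂ} (hu : ∀ i (ζ : ℂ), uikPoly (κ i) (u i) ζ = 0 → ζ.im = 0 ∧ ζ.re ≤ 0)
    (hF : degreeWeightedPolynomial E wt u ≠ 0) {s : ℂ} (hs : edgeCountPoly E wt u s = 0) :
    s.im = 0 ∧ s.re ≤ 0 := by
  by_contra hnot
  obtain ⟨r, hr⟩ := IsAlgClosed.exists_pow_nat_eq (-s) two_pos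
  -- `r` is not real, since `-s ∉ [0, ∞)`
  have hr_im : r.im ≠ 0 := by
    intro h0
    apply hnot
    have hre : (r ^ 2).re = r.re * r.re - r.im * r.im := by rw [sq, Complex.mul_re]
    have him : (r ^ 2).im = r.re * r.im + r.im * r.re := by rw [sq, Complex.mul_im]
    rw [hr, Complex.neg_re] at hre
    rw [hr, Complex.neg_im, h0, mul_zero, zero_mul, add_zero, neg_eq_zero] at him
    refine ⟨him, ?_⟩
    rw [h0, mul_zero, sub_zero] at hre
    nlinarith [mul_self_nonneg r.re]
  -- a square root `t` of `-s` in the open upper half-plane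
  obtain ⟨t, ht, htim⟩ : ∃ t : ℂ, t ^ 2 = -s ∧ 0 < t.im := by
    rcases lt_or_gt_of_ne hr_im with h | h
    · exact ⟨-r, by rw [neg_sq, hr], by rw [Complex.neg_im]; linarith⟩
    · exact ⟨r, hr, h⟩
  have hstab := (wagner_degreeWeightedPolynomial_weaklyHurwitzStable hE hκ hwt hu).resolve_right hF
  rw [isHThetaStable_pi_div_two_iff] at hstab
  refine hstab (fun _ => -Complex.I * t) (fun _ => ?_) ?_
  · simp [Complex.mul_re, htim]
  · rw [eval_const_degreeWeightedPolynomial hE]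
    have h2 : (-Complex.I * t) ^ 2 = s := by
      rw [mul_pow, neg_sq, Complex.I_sq, ht]; ring
    rw [h2]
    exact hs

end Univariate

end Literature.Combinatorics.StablePolynomials

end
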